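import Summits.QuantumAdvantage.QuantumAdvantage.Theorems.SosSandwichPseudoBoundedAALevelKRung
import Summits.QuantumAdvantage.QuantumAdvantage.Theorems.SosSandwichPseudoBoundedAAChebyshevCoefficientBound
import HarnessLib

/-!
# Route `SosSandwich`, crux `PseudoBoundedAA` (stmt-QuantumAdvantage-15237): the level-`k` rung with the
# Chebyshev-coefficient constant (`d`-exponent `k + 1` instead of `2k - 1`)

The tree's level-`k` rung (`LevelKRung.exists_influence_ge_levelK`): every `[0,1]`-bounded real polynomial `p` of
total degree `≤ d` on `{0,1}^N` has a variable with `16·(k!)²·W_k[p]² ≤ 9^{k-1}·(2k+1)²·d^{4k-2}·Inf_i[p]`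
(`W_k = Σ_{|S|=k} p̂(S)²`), the factor `d^{4k-2}` being the square of the iterated-Markov sup bound
`d^{2k-1}/(2·k!)` of the level-`k` part.  This file (item (3) of the level-`k` repair census):

* §1 `exists_influence_ge_levelK_of_supBound` — the rung with the sup bound as a PARAMETER: if
  `|Σ_{|S|=k} p̂(S) χ_S(z)| ≤ L` for all sign patterns `z`, then some variable has
  `4·W_k[p]² ≤ 9^{k-1}·(2k+1)²·L²·Inf_i[p]` (Littlewood's mixed-norm route of the tree file, verbatim: rows
  `4 r_i² ≤ Inf_i`, `Σ_i r_i² = k W_k`, `Σ_i r_i ≤ 3^{k-1}(2k²+k) L`).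
* §2 `exists_influence_ge_levelK_chebyshev` — with the Chebyshev-coefficient sup bound
  `L = d·(2d)^k/k!` (`ChebyshevCoefficientBound.abs_levelK_sum_le_chebyshev` with `M = 1/2` for `p - 1/2`):
  `4·(k!)²·W_k[p]² ≤ 9^{k-1}·(2k+1)²·d²·(2d)^{2k}·Inf_i[p]`, i.e. `d^{4k-2} ↦ 4^{k+1} d^{2k+2}` in the tree's
  normalisation (better as soon as `d^{2k-4} > 4^{k+1}`; the `9^{k-1}` Bonami factor and the `T^{O(T)}` total are
  untouched — the open content of the crux, `AA_Q` uniform in `T`, is not addressed).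

* §3 `exists_influence_ge_levelK_chebyshev_query` / `…_pseudoBounded` — the same on `Q_T` and on `K_T` (`d = 2T`).

Honest label: support lemmas (constants of the general bottom rung); no stub, crux or summit is proved.
Sources: Rivlin 1974 Sect. 2.7, (1.96), Ex. 1.5.27; O'Donnell 2014 Thm. 9.21, §2.2; Aaronson–Ambainis 2014 Conj. 6.
-/

-- D-0017: single-conjunct summit ⇒ the duplicate `QuantumAdvantage.QuantumAdvantage` is mandated.
set_option linter.dupNamespace false

noncomputable section

namespace Summit.QuantumAdvantage.QuantumAdvantage.Theorems.SosSandwich.LevelKRungChebyshev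

open Finset
open Literature.Computability.QuantumComplexity
open Literature.Computability.Complexity.LowDegree (cubeFourierCoeff IsLevelLE)
open Literature.Probability.RandomGraphs.LowDegree (walsh)
open Summit.QuantumAdvantage.QuantumAdvantage.Theorems.SosSandwich.LevelOneRung
open Summit.QuantumAdvantage.QuantumAdvantage.Theorems.SosSandwich.LevelKRung
open Summit.QuantumAdvantage.QuantumAdvantage.Theorems.SosSandwich.ChebyshevCoefficientBound
  (abs_levelK_sum_le_chebyshev)
open Literature.Computability.Cryptography (QQueryAlg)

variable {N : ℕ}

/-! ### §1 The level-`k` rung with the sup bound of the level-`k` part as a parameter -/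

/-- **Level-`k` rung, parametric form.**  For `k ≥ 1`, `N ≥ 1` and a real polynomial `p` on `{0,1}^N` whose
level-`k` part is `L`-bounded in sup norm (`|Σ_{|S|=k} p̂(S) χ_S(z)| ≤ L` for all `z`), some variable `i` has
`4·W_k[p]² ≤ 9^{k-1}·(2k+1)²·L²·Inf_i[p]`, `W_k[p] = Σ_{|S|=k} p̂(S)²`.
[cite: ODonnell2014, Thm. 9.21, §2.2] [cite: AaronsonAmbainis2014, Conj. 6] -/
theorem exists_influence_ge_levelK_of_supBound {k : ℕ} (hk : 1 ≤ k) (p : MvPolynomial (Fin N) ℝ) (hN : 0 < N)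
    {L : ℝ}
    (hLsup : ∀ z : Fin N → Bool,
      |∑ S ∈ univ.filter (fun S : Finset (Fin N) => S.card = k), cubeFourierCoeff (evalBool p) S * walsh S z| ≤ L) :
    ∃ i : Fin N, 4 *
        (∑ S ∈ univ.filter (fun S : Finset (Fin N) => S.card = k), cubeFourierCoeff (evalBool p) S ^ 2) ^ 2 ≤
      (9 : ℝ) ^ (k - 1) * (2 * k + 1) ^ 2 * L ^ 2 * influence i p := by
  classical
  haveI : Nonempty (Fin N) := Fin.pos_iff_nonempty.mp hN
  -- rows: `Σ_i |row_i(u)| ≤ (2k²+k)·L`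
  have hrows : ∀ u : Fin N → Bool,
      ∑ i, |∑ S ∈ univ.filter (fun S : Finset (Fin N) => S.card = k ∧ i ∈ S),
        cubeFourierCoeff (evalBool p) S * walsh (S.erase i) u| ≤ (2 * (k : ℝ) ^ 2 + k) * L :=
    fun u => sum_abs_row_le hLsup u
  -- `r_i`, `Σ r_i ≤ 3^{k-1}(2k²+k)L`, `Σ r_i² = k W_k`
  set R : Fin N → ℝ := fun i => ∑ S ∈ univ.filter (fun S : Finset (Fin N) => S.card = k ∧ i ∈ S),
    cubeFourierCoeff (evalBool p) S ^ 2 with hR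
  set r : Fin N → ℝ := fun i => Real.sqrt (R i) with hr
  have hR0 : ∀ j, 0 ≤ R j := fun j => Finset.sum_nonneg fun S _ => sq_nonneg _
  have hr0 : ∀ j, 0 ≤ r j := fun j => Real.sqrt_nonneg _
  have hrsq : ∀ j, r j ^ 2 = R j := fun j => Real.sq_sqrt (hR0 j)
  set A : ℝ := (3 : ℝ) ^ (k - 1) * ((2 * (k : ℝ) ^ 2 + k) * L) with hA
  have hsumr : ∑ j, r j ≤ A := by
    have h2N : (0 : ℝ) < (2 : ℝ) ^ N := by positivity
    have h1 : ∀ j, (2 : ℝ) ^ N * r j ≤ (3 : ℝ) ^ (k - 1) * ∑ u : Fin N → Bool,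
        |∑ S ∈ univ.filter (fun S : Finset (Fin N) => S.card = k ∧ j ∈ S),
          cubeFourierCoeff (evalBool p) S * walsh (S.erase j) u| := fun j => khintchine_row (evalBool p) k j
    have h2 : (2 : ℝ) ^ N * ∑ j, r j ≤ (3 : ℝ) ^ (k - 1) * ∑ u : Fin N → Bool, ∑ j,
        |∑ S ∈ univ.filter (fun S : Finset (Fin N) => S.card = k ∧ j ∈ S),
          cubeFourierCoeff (evalBool p) S * walsh (S.erase j) u| := by
      rw [Finset.mul_sum, Finset.sum_comm, Finset.mul_sum]
      exact Finset.sum_le_sum fun j _ => h1 j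
    have h3 : ∑ u : Fin N → Bool, ∑ j,
        |∑ S ∈ univ.filter (fun S : Finset (Fin N) => S.card = k ∧ j ∈ S),
          cubeFourierCoeff (evalBool p) S * walsh (S.erase j) u| ≤ (2 : ℝ) ^ N * ((2 * (k : ℝ) ^ 2 + k) * L) := by
      have hc : ∑ _u : Fin N → Bool, ((2 * (k : ℝ) ^ 2 + k) * L) = (2 : ℝ) ^ N * ((2 * (k : ℝ) ^ 2 + k) * L) := by
        simp [Finset.card_univ, Fintype.card_fin]
      rw [← hc]
      exact Finset.sum_le_sum fun u _ => hrows u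
    have h39 : (0 : ℝ) ≤ (3 : ℝ) ^ (k - 1) := by positivity
    have h4 : (2 : ℝ) ^ N * ∑ j, r j ≤ (2 : ℝ) ^ N * A := by
      calc (2 : ℝ) ^ N * ∑ j, r j ≤ _ := h2
        _ ≤ (3 : ℝ) ^ (k - 1) * ((2 : ℝ) ^ N * ((2 * (k : ℝ) ^ 2 + k) * L)) := mul_le_mul_of_nonneg_left h3 h39
        _ = (2 : ℝ) ^ N * A := by rw [hA]; ring
    exact le_of_mul_le_mul_left h4 h2N
  set W := ∑ S ∈ univ.filter (fun S : Finset (Fin N) => S.card = k), cubeFourierCoeff (evalBool p) S ^ 2 with hW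
  have hkW : ∑ j, r j ^ 2 = (k : ℝ) * W := by
    simp_rw [hrsq]
    exact sum_sum_filter_card_mem k (fun S => cubeFourierCoeff (evalBool p) S ^ 2)
  -- the maximal row
  obtain ⟨i, -, hi⟩ := Finset.exists_max_image Finset.univ r Finset.univ_nonempty
  refine ⟨i, ?_⟩
  have hmax : ∀ j, r j ≤ r i := fun j => hi j (Finset.mem_univ j)
  have hsq_le : (k : ℝ) * W ≤ r i * A := by
    rw [← hkW]
    calc ∑ j, r j ^ 2 = ∑ j, r j * r j := Finset.sum_congr rfl fun j _ => sq (r j)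
      _ ≤ ∑ j, r i * r j := Finset.sum_le_sum fun j _ => mul_le_mul_of_nonneg_right (hmax j) (hr0 j)
      _ = r i * ∑ j, r j := by rw [Finset.mul_sum]
      _ ≤ r i * A := mul_le_mul_of_nonneg_left hsumr (hr0 i)
  have hinf : 4 * r i ^ 2 ≤ influence i p := by
    rw [hrsq]; exact four_mul_rowWeightK_le_influence p k i
  have hW0 : 0 ≤ W := Finset.sum_nonneg fun S _ => sq_nonneg _
  have hk0 : (0 : ℝ) < k := by exact_mod_cast hk
  have hsq : ((k : ℝ) * W) ^ 2 ≤ (r i * A) ^ 2 := pow_le_pow_left₀ (by positivity) hsq_le 2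
  -- `A² = 9^{k-1} k² (2k+1)² L²`
  have hA2 : A ^ 2 = (9 : ℝ) ^ (k - 1) * (k : ℝ) ^ 2 * (2 * k + 1) ^ 2 * L ^ 2 := by
    have e9 : ((3 : ℝ) ^ (k - 1)) ^ 2 = (9 : ℝ) ^ (k - 1) := by
      rw [← pow_mul, show (9 : ℝ) = 3 ^ 2 by norm_num, ← pow_mul]; ring_nf
    have eA : A = (3 : ℝ) ^ (k - 1) * ((k : ℝ) * (2 * k + 1)) * L := by rw [hA]; ring
    rw [eA, ← e9]
    ring
  have hX0 : (0 : ℝ) ≤ (9 : ℝ) ^ (k - 1) * (k : ℝ) ^ 2 * (2 * k + 1) ^ 2 * L ^ 2 := by positivity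
  -- conclude, cancelling `k² > 0`
  have key : (k : ℝ) ^ 2 * (4 * W ^ 2) ≤
      (k : ℝ) ^ 2 * ((9 : ℝ) ^ (k - 1) * (2 * k + 1) ^ 2 * L ^ 2 * influence i p) := by
    have h1 : 4 * ((k : ℝ) * W) ^ 2 ≤ 4 * (r i * A) ^ 2 := mul_le_mul_of_nonneg_left hsq (by norm_num)
    have h2 : 4 * (r i * A) ^ 2 = (4 * r i ^ 2) * ((9 : ℝ) ^ (k - 1) * (k : ℝ) ^ 2 * (2 * k + 1) ^ 2 * L ^ 2) := by
      rw [mul_pow, hA2]; ring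
    have h3 : (4 * r i ^ 2) * ((9 : ℝ) ^ (k - 1) * (k : ℝ) ^ 2 * (2 * k + 1) ^ 2 * L ^ 2) ≤
        influence i p * ((9 : ℝ) ^ (k - 1) * (k : ℝ) ^ 2 * (2 * k + 1) ^ 2 * L ^ 2) :=
      mul_le_mul_of_nonneg_right hinf hX0
    calc (k : ℝ) ^ 2 * (4 * W ^ 2) = 4 * ((k : ℝ) * W) ^ 2 := by ring
      _ ≤ influence i p * ((9 : ℝ) ^ (k - 1) * (k : ℝ) ^ 2 * (2 * k + 1) ^ 2 * L ^ 2) := by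
          rw [h2] at h1; exact h1.trans h3
      _ = (k : ℝ) ^ 2 * ((9 : ℝ) ^ (k - 1) * (2 * k + 1) ^ 2 * L ^ 2 * influence i p) := by ring
  exact le_of_mul_le_mul_left key (by positivity)

/-! ### §2 The level-`k` rung with the Chebyshev-coefficient constant -/

/-- **The level-`k` rung, Chebyshev constant.**  For `k ≥ 1` and a real polynomial `p` of total degree `≤ d` with
`0 ≤ p ≤ 1` on `{0,1}^N`, `N ≥ 1`, some variable `i` has
`4·(k!)²·W_k[p]² ≤ 9^{k-1}·(2k+1)²·d²·(2d)^{2k}·Inf_i[p]` (`W_k[p] = Σ_{|S|=k} p̂(S)²`); the tree's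
`exists_influence_ge_levelK` has `16·(k!)²·W_k² ≤ 9^{k-1}(2k+1)² d^{4k-2}·Inf_i`.
[cite: Rivlin1974, Sect. 2.7 (2.38)-(2.42); Sect. 1.5 (1.96)] [cite: ODonnell2014, Thm. 9.21, §2.2]
[cite: AaronsonAmbainis2014, Conj. 6] -/
theorem exists_influence_ge_levelK_chebyshev {d k : ℕ} (hk : 1 ≤ k) {p : MvPolynomial (Fin N) ℝ} (hN : 0 < N)
    (hp : p.totalDegree ≤ d) (hb : ∀ x, 0 ≤ evalBool p x ∧ evalBool p x ≤ 1) :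
    ∃ i : Fin N, 4 * (k.factorial : ℝ) ^ 2 *
        (∑ S ∈ univ.filter (fun S : Finset (Fin N) => S.card = k), cubeFourierCoeff (evalBool p) S ^ 2) ^ 2 ≤
      (9 : ℝ) ^ (k - 1) * (2 * k + 1) ^ 2 * ((d : ℝ) ^ 2 * (2 * (d : ℝ)) ^ (2 * k)) * influence i p := by
  classical
  -- the centred function and the Chebyshev sup bound of its level-`k` part
  have hM : ∀ x, |evalBool p x - 1 / 2| ≤ 1 / 2 := fun x => by
    rw [abs_le]; constructor <;> linarith [(hb x).1, (hb x).2]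
  have hdeg : IsLevelLE d (fun x => evalBool p x - 1 / 2) := fun S hS => by
    have hS0 : S ≠ ∅ := by rintro rfl; simp at hS
    rw [cubeFourierCoeff_sub_const _ hS0]
    exact cubeFourierCoeff_evalBool_eq_zero hp hS
  have hcoef : ∀ S : Finset (Fin N), S.card = k →
      cubeFourierCoeff (fun x => evalBool p x - 1 / 2) S = cubeFourierCoeff (evalBool p) S := by
    intro S hS
    refine cubeFourierCoeff_sub_const _ ?_
    rintro rfl; simp at hS; omega
  set L : ℝ := (d : ℝ) * (2 * (d : ℝ)) ^ k / (k.factorial : ℝ) with hL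
  have hLsup : ∀ z : Fin N → Bool,
      |∑ S ∈ univ.filter (fun S : Finset (Fin N) => S.card = k), cubeFourierCoeff (evalBool p) S * walsh S z|
        ≤ L := by
    intro z
    have h := abs_levelK_sum_le_chebyshev hdeg hM hk z
    have e : ∑ S ∈ univ.filter (fun S : Finset (Fin N) => S.card = k),
        cubeFourierCoeff (fun x => evalBool p x - 1 / 2) S * walsh S z =
        ∑ S ∈ univ.filter (fun S : Finset (Fin N) => S.card = k), cubeFourierCoeff (evalBool p) S * walsh S z :=
      Finset.sum_congr rfl fun S hS => by rw [hcoef S (Finset.mem_filter.mp hS).2]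
    rw [e] at h
    refine h.trans (le_of_eq ?_)
    rw [hL]; ring
  obtain ⟨i, hi⟩ := exists_influence_ge_levelK_of_supBound hk p hN hLsup
  refine ⟨i, ?_⟩
  set W := ∑ S ∈ univ.filter (fun S : Finset (Fin N) => S.card = k), cubeFourierCoeff (evalBool p) S ^ 2 with hW
  have hfac : (0 : ℝ) < (k.factorial : ℝ) := by positivity
  -- multiply the parametric rung by `(k!)²` and expand `L² (k!)² = d² (2d)^{2k}`
  have hL2 : L ^ 2 * (k.factorial : ℝ) ^ 2 = (d : ℝ) ^ 2 * (2 * (d : ℝ)) ^ (2 * k) := by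
    rw [hL, div_pow, div_mul_cancel₀ _ (by positivity), mul_pow, ← pow_mul, mul_comm k 2]
  have h1 : (k.factorial : ℝ) ^ 2 * (4 * W ^ 2) ≤
      (k.factorial : ℝ) ^ 2 * ((9 : ℝ) ^ (k - 1) * (2 * k + 1) ^ 2 * L ^ 2 * influence i p) :=
    mul_le_mul_of_nonneg_left hi (by positivity)
  calc 4 * (k.factorial : ℝ) ^ 2 * W ^ 2 = (k.factorial : ℝ) ^ 2 * (4 * W ^ 2) := by ring
    _ ≤ (k.factorial : ℝ) ^ 2 * ((9 : ℝ) ^ (k - 1) * (2 * k + 1) ^ 2 * L ^ 2 * influence i p) := h1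
    _ = (9 : ℝ) ^ (k - 1) * (2 * k + 1) ^ 2 * (L ^ 2 * (k.factorial : ℝ) ^ 2) * influence i p := by ring
    _ = (9 : ℝ) ^ (k - 1) * (2 * k + 1) ^ 2 * ((d : ℝ) ^ 2 * (2 * (d : ℝ)) ^ (2 * k)) * influence i p := by
        rw [hL2]

/-! ### §3 Consequences on `Q_T` and `K_T` (`d = 2T`) -/

/-- **The level-`k` rung on `Q_T`, Chebyshev constant** (`d = 2T`): for a `T`-query quantum algorithm on `N ≥ 1`
bits and a real polynomial `p` with its acceptance probabilities as cube values, some variable has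
`4·(k!)²·W_k[p]² ≤ 9^{k-1}·(2k+1)²·(2T)²·(4T)^{2k}·Inf_i[p]`.
[cite: BealsEtAl2001, Lemma 4.2] [cite: AaronsonAmbainis2014, Conj. 6] [cite: Rivlin1974, Sect. 2.7 (2.38)-(2.42)] -/
theorem exists_influence_ge_levelK_chebyshev_query {k : ℕ} (hk : 1 ≤ k) (hN : 0 < N) (Q : QQueryAlg N)
    (p : MvPolynomial (Fin N) ℝ) (hp : ∀ x, evalBool p x = Q.acceptProb x) :
    ∃ i : Fin N, 4 * (k.factorial : ℝ) ^ 2 *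
        (∑ S ∈ univ.filter (fun S : Finset (Fin N) => S.card = k), cubeFourierCoeff (evalBool p) S ^ 2) ^ 2 ≤
      (9 : ℝ) ^ (k - 1) * (2 * k + 1) ^ 2 *
        ((((2 * Q.queries : ℕ) : ℝ)) ^ 2 * (2 * ((2 * Q.queries : ℕ) : ℝ)) ^ (2 * k)) * influence i p := by
  obtain ⟨p₀, hdeg, hval⟩ := exists_acceptPolynomial Q
  have heq : evalBool p = evalBool p₀ := funext fun x => by rw [hp x]; exact hval x
  have hb : ∀ x, 0 ≤ evalBool p₀ x ∧ evalBool p₀ x ≤ 1 := fun x => by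
    have hx : evalBool p₀ x = Q.acceptProb x := (hval x).symm
    rw [hx]
    exact ⟨Q.acceptProb_nonneg x, Q.acceptProb_le_one' x⟩
  obtain ⟨i, hi⟩ := exists_influence_ge_levelK_chebyshev hk hN hdeg hb
  refine ⟨i, ?_⟩
  have hinf : influence i p = influence i p₀ := by unfold influence; rw [heq]
  rw [heq, hinf]
  exact hi

/-- **The level-`k` rung on `K_T`, Chebyshev constant** (`d = 2T`): for `p` pseudo-bounded of order `T` (`p` and
`1 - p` sums of squares of degree-`≤ T` polynomials on the cube) on `N ≥ 1` bits, some variable has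
`4·(k!)²·W_k[p]² ≤ 9^{k-1}·(2k+1)²·(2T)²·(4T)^{2k}·Inf_i[p]`.
[cite: KaniewskiLeeDewolf2015, Def. 7] [cite: AaronsonAmbainis2014, Conj. 6] [cite: Rivlin1974, Sect. 2.7 (2.38)-(2.42)] -/
theorem exists_influence_ge_levelK_chebyshev_pseudoBounded {k T : ℕ} (hk : 1 ≤ k) (hN : 0 < N)
    {p : MvPolynomial (Fin N) ℝ} (h : PseudoBounded T p) :
    ∃ i : Fin N, 4 * (k.factorial : ℝ) ^ 2 *
        (∑ S ∈ univ.filter (fun S : Finset (Fin N) => S.card = k), cubeFourierCoeff (evalBool p) S ^ 2) ^ 2 ≤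
      (9 : ℝ) ^ (k - 1) * (2 * k + 1) ^ 2 *
        ((((2 * T : ℕ) : ℝ)) ^ 2 * (2 * ((2 * T : ℕ) : ℝ)) ^ (2 * k)) * influence i p := by
  obtain ⟨p', hdeg, hb, heq⟩ := exists_representative_of_pseudoBounded h
  obtain ⟨i, hi⟩ := exists_influence_ge_levelK_chebyshev hk hN hdeg hb
  refine ⟨i, ?_⟩
  have hinf : influence i p' = influence i p := by unfold influence; rw [heq]
  rw [heq, hinf] at hi
  exact hi

end Summit.QuantumAdvantage.QuantumAdvantage.Theorems.SosSandwich.LevelKRungChebyshev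

end
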